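import Summits.ValiantsHypothesis.ValiantsHypothesis.Theorems.LacunarySymmetroidMatrixDescartesCensusPencilPlaneLaw

/-!
# Span-rank rows of the census: frame lemmas

Line `span-rank` of crux `MatrixDescartes` (stmt-18050).  `SpanRootLawAt m K r bound` (defined in
`…CensusPencilPlaneLaw`) is monotone in the bound and ANTITONE in the span rank `r`; at `r = K` it is the general
(not necessarily symmetric) positive-root row and implies the census row `PosRootLawAt m K bound`; at `m = 2` the
symmetric letters span the 3-space `⟨E₁₁, E₁₂+E₂₁, E₂₂⟩`, so the `(2,K)` column of the census is bounded by the
span-rank-3 row: `SpanRootLawAt 2 K 3 b → PosRootLawAt 2 K b`.  0 sorry; nothing on B / `MatrixDescartes`.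
-/

set_option linter.dupNamespace false
set_option linter.unusedVariables false

namespace Summit.ValiantsHypothesis.ValiantsHypothesis.Theorems.LacunarySymmetroidMatrixDescartes.Census.SpanRank

open Polynomial Matrix Finset
open scoped BigOperators
open Summit.ValiantsHypothesis.ValiantsHypothesis.Theorems.MatrixDescartes.Negative (PosRootLawAt)
open Summit.ValiantsHypothesis.ValiantsHypothesis.Theorems.LacunarySymmetroidMatrixDescartes.Census.SignSplit
  (pencil posRootCount)

/-- Monotonicity in the bound. [this file] -/
theorem spanRootLawAt_mono {m K r b b' : ℕ} (hbb' : b ≤ b') (h : SpanRootLawAt m K r b) : SpanRootLawAt m K r b' :=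
  fun d B c => (h d B c).trans hbb'

/-- Antitonicity in the span rank: a law for `r'`-spans gives the law for `r`-spans, `r ≤ r'` (pad the basis with zero
matrices). [this file] -/
theorem spanRootLawAt_of_rank_le {m K r r' b : ℕ} (hr : r ≤ r') (h : SpanRootLawAt m K r' b) : SpanRootLawAt m K r b := by
  obtain ⟨e, rfl⟩ := Nat.exists_eq_add_of_le hr
  intro d B c
  let B' : Fin (r + e) → Matrix (Fin m) (Fin m) ℝ := Fin.append B (fun _ => 0)
  let c' : Fin K → Fin (r + e) → ℝ := fun l => Fin.append (c l) (fun _ => 0)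
  have hS : (fun l => ∑ i, c' l i • B' i) = (fun l => ∑ i, c l i • B i) := by
    funext l
    rw [Fin.sum_univ_add]
    simp [B', c', Fin.append_left, Fin.append_right]
  have := h d B' c'
  rw [hS] at this
  exact this

/-- The general positive-root law at format `(m,K)` (no symmetry) gives every span-rank row. [this file] -/
theorem spanRootLawAt_of_general {m K r b : ℕ}
    (h : ∀ (d : Fin K → ℕ) (S : Fin K → Matrix (Fin m) (Fin m) ℝ), posRootCount d S ≤ b) : SpanRootLawAt m K r b :=
  fun d B c => h d _

/-- The span-rank-`K` row is the general row: every `K`-letter family is its own `K`-net. [this file] -/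
theorem general_of_spanRootLawAt_self {m K b : ℕ} (h : SpanRootLawAt m K K b)
    (d : Fin K → ℕ) (S : Fin K → Matrix (Fin m) (Fin m) ℝ) : posRootCount d S ≤ b := by
  classical
  have hS : (fun l => ∑ i, (fun l' i => if l' = i then (1 : ℝ) else 0) l i • S i) = S := by
    funext l
    simp [ite_smul, Finset.sum_ite_eq]
  have := h d S (fun l' i => if l' = i then (1 : ℝ) else 0)
  rw [hS] at this
  exact this

/-- Hence the span-rank-`K` row implies the census row `PosRootLawAt m K b` (symmetric pencils). [this file] -/
theorem posRootLawAt_of_spanRootLawAt_self {m K b : ℕ} (h : SpanRootLawAt m K K b) : PosRootLawAt m K b := by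
  intro d S _
  exact general_of_spanRootLawAt_self h d S

/-- More generally any row with `K ≤ r` implies the census row. [this file] -/
theorem posRootLawAt_of_spanRootLawAt {m K r b : ℕ} (hr : K ≤ r) (h : SpanRootLawAt m K r b) : PosRootLawAt m K b :=
  posRootLawAt_of_spanRootLawAt_self (spanRootLawAt_of_rank_le hr h)

/-- **The `(2,K)` column is bounded by the span-rank-3 row**: symmetric `2 × 2` letters lie in the span of
`E₁₁, E₁₂ + E₂₁, E₂₂`. [this file] -/
theorem posRootLawAt_two_of_spanRootLawAt_three {K b : ℕ} (h : SpanRootLawAt 2 K 3 b) : PosRootLawAt 2 K b := by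
  intro d S hS
  let B : Fin 3 → Matrix (Fin 2) (Fin 2) ℝ := ![!![1, 0; 0, 0], !![0, 1; 1, 0], !![0, 0; 0, 1]]
  let c : Fin K → Fin 3 → ℝ := fun l => ![S l 0 0, S l 0 1, S l 1 1]
  have h10 : ∀ l, S l 1 0 = S l 0 1 := fun l => (hS l).apply 0 1
  have hSl : (fun l => ∑ i, c l i • B i) = S := by
    funext l
    ext i j
    fin_cases i <;> fin_cases j <;> simp [B, c, Fin.sum_univ_three, h10]
  have := h d B c
  rw [hSl] at this
  exact this

/-- Read together with `spanRootLawAt_two_iff`: at `m = 2` the whole excess of the census column `(2,K)` over the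
skeleton value `2(K−1)` (`9 − 6`, `14 − 8`, …) is carried by span rank `3`. [this file] -/
theorem posRootLawAt_two_skeleton (K : ℕ) : SpanRootLawAt 2 K 2 (2 * (K - 1)) := spanRootLawAt_two 2 K

end Summit.ValiantsHypothesis.ValiantsHypothesis.Theorems.LacunarySymmetroidMatrixDescartes.Census.SpanRank
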